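import Literature.AlgebraicGeometry.Motives.AbelianVariety
import Literature.AlgebraicGeometry.HodgeTheory.GysinFormalism
import Literature.AlgebraicGeometry.HodgeTheory.TorusRationalClasses
import Literature.AlgebraicTopology.SingularHomology.TorusCohomologyRing
import Literature.Geometry.Kaehler.ComplexTorusAverage
import Literature.NumberTheory.EllipticCurves.ComplexTorusAnalytification
import Literature.NumberTheory.EllipticCurves.ComplexTorusAddProofs
import Literature.NumberTheory.EllipticCurves.AbelianVarietyBridgeFullProofs
import Literature.NumberTheory.EllipticCurves.WeierstrassAddHomPoints
import HarnessLib

/-!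
# Crux `WeilTwelvefoldsSqrtMinus7` (stmt-HodgeConjecture-1261), line `amnesic-secant-sheaves-split-fourteenfolds` — stub `stub_torusModel` (T_A2)

**The degree-one cohomological model of an endomorphism of `E_Λ` acting linearly on the
uniformisation.** Let `L` be a period pair (lattice `Λ = ℤω₁ + ℤω₂`), `E_Λ` its Weierstrass cubic
as an abelian variety over `ℂ` (`WeierstrassCurve.abelianVarietyOfAddHom`), `w ∈ ℂ` with
`w·ωⱼ = Σₖ Nⱼₖ ωₖ` for an integer matrix `N`, and `ι` an endomorphism of `E_Λ` acting on complex
points as `π(z) ↦ π(wz)` (`π = PeriodPair.upoint : ℂ → E_Λ(ℂ)`). Then `H¹(E_Λ(ℂ); ℂ)` has a basis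
of two RATIONAL classes `x₀, x₁` on which `ι^*` acts by the transpose of `N`
(`ι^* xᵢ = Σⱼ Nⱼᵢ xⱼ`), pull-back of the `xᵢ` is additive in the morphism, `x₀ ⌣ x₁ ≠ 0`, and
`H²(E_Λ(ℂ); ℂ) = ℂ·(x₀ ⌣ x₁)`.

Proof (Hatcher, *Algebraic Topology*, §3.2 Example 3.16 and §3.C Exercise 11, on the tree's real
carriers; the blueprint is `Theorems/HeckePrymWeilHeckePrymAnchorsWeilSurface`, which does this for
`Λ = ℤ + iℤ`): the uniformisation `Θ : T² = ℂ/Λ ≃ₜ E_Λ(ℂ)` (`PeriodPair.isHomeomorph_torusPoint`,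
`Θ(π_T(z)) = π(z)`) is a group isomorphism, because the glued addition morphism of `E_Λ` is the
chord–tangent law on `ℂ`-points (`WeierstrassCurve.lift_pointEquiv_comp_addHom_of_field`) and
`z ↦ (℘(z), ℘'(z)/2)` is a homomorphism (`PeriodPair.toPoint_add_holds`). Put
`xᵢ = (Θ⁻¹)^* ξᵢ` for the coordinate classes `ξᵢ = prᵢ^* θ` of `T²`. For `z = x₀ω₁ + x₁ω₂`,
`wz = Σₖ (Σⱼ xⱼ Nⱼₖ) ωₖ`, so `Θ` conjugates `ι(ℂ)` to the torus map `f_A` of `A = Nᵀ`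
(`torusMap`), and `f_A^* ξᵢ = Σⱼ Aᵢⱼ ξⱼ` (`map_torusMap_torusXi`) gives `ι^* xᵢ = Σⱼ Nⱼᵢ xⱼ`.
Additivity: `(f + g)(ℂ) = f(ℂ)·g(ℂ)` pointwise (`MonObj.comp_mul`), `Θ⁻¹` is additive, and
`(u + v)^* θ = u^* θ + v^* θ` for maps to `ℝ/ℤ` (`map_add_circleClass`). Finally
`(Θ⁻¹)^* : H•(T²) ≅ H•(E_Λ(ℂ))` transports the cup-monomial basis: `H¹` has dimension `2` and is
spanned by `x₀, x₁` (hence they are independent), `H²` has dimension `1` and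
`x₀ ⌣ x₁ = (Θ⁻¹)^*(ξ₀ ⌣ ξ₁) ≠ 0` (`torusTop_ne_zero`, `finrank_singularCohomology_torus`);
rationality is `isRationalClass_ringChange` (`ξᵢ` is defined over `ℚ`, `ringChange_torusXi`)
and `IsRationalClass.map`.

The `tm_*` theorems are the helpers of this stub: the purely topological ones are stated for an
arbitrary homeomorphism `Θ : T² ≃ₜ Y` (the classes being `(Θ⁻¹)^* ξᵢ`), the group-theoretic ones
for `Y = A(ℂ)`, `A` an abelian variety, and `Θ` multiplicative; the two facts about `E_Λ` proper
are `tm_torusPoint_add` (the uniformisation is a homomorphism) and `tm_torusPoint_conj` (it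
conjugates `z ↦ wz` to `f_{Nᵀ}`). No definitions are introduced.
-/

noncomputable section

-- `Summit.HodgeConjecture.HodgeConjecture.…` is the tree's fixed summit/problem namespace scheme.
set_option linter.dupNamespace false

open CategoryTheory Complex MonoidalCategory CartesianMonoidalCategory
open Literature.AlgebraicGeometry Literature.AlgebraicGeometry.Motives Literature.AlgebraicGeometry.HodgeTheory
open Literature.AlgebraicTopology.SingularHomology Literature.Geometry.Kaehler

namespace Summit.HodgeConjecture.HodgeConjecture.Theorems.WeilTwelvefoldsSqrtMinus7.AmnesicSecantSheaves

/-! ### The uniformisation of `E_Λ` is a homomorphism conjugating `z ↦ wz` to a torus map -/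

section Curve

variable (L : PeriodPair)

/-- `[P + Q] = ⟨[P], [Q]⟩ ≫ addHom` in `E_Λ(ℂ)`: the glued addition is the chord–tangent law on
`ℂ`-points. [cite: SilvermanAEC2009, III.3.6] -/
theorem tm_pointEquiv_add (a b : L.curve.toAffine.Point) :
    L.curve.pointEquiv (a + b) = lift (L.curve.pointEquiv a) (L.curve.pointEquiv b) ≫ L.curve.addHom :=
  (L.curve.lift_pointEquiv_comp_addHom_of_field (L := ℂ) a b).symm

/-- **`φ : ℂ/Λ → E_Λ(ℂ)` is a homomorphism** (`toPoint_add_holds`).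
[cite: SilvermanAEC2009, Prop. VI.3.6 (b)] -/
theorem tm_torusPoint_add (s t : L.torus) :
    L.torusPoint (s + t) = lift (L.torusPoint s) (L.torusPoint t) ≫ L.curve.addHom := by
  obtain ⟨z, rfl⟩ := ComplexTorus.cover_surjective L.periodIso s
  obtain ⟨w, rfl⟩ := ComplexTorus.cover_surjective L.periodIso t
  rw [← ComplexTorus.cover_add, PeriodPair.torusPoint_cover, PeriodPair.torusPoint_cover,
    PeriodPair.torusPoint_cover]
  change L.curve.pointEquiv (L.toPoint (z + w)) = _
  rw [L.toPoint_add_holds z w]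
  exact tm_pointEquiv_add L _ _

/-- **`φ` conjugates `z ↦ wz` to the torus map of `Nᵀ`**: if `w·ωⱼ = Σₖ Nⱼₖ ωₖ` and a self-map `k`
of `E_Λ` acts on complex points as `π(z) ↦ π(wz)`, then `k(φ t) = φ(f_{Nᵀ} t)` (for
`z = x₀ω₁ + x₁ω₂`, `wz = Σₖ (Σⱼ xⱼNⱼₖ) ωₖ`). [cite: HatcherAT2002, §3.C Exercise 11] -/
theorem tm_torusPoint_conj {w : ℂ} {N : Matrix (Fin 2) (Fin 2) ℤ} {k : L.curve.scheme ⟶ L.curve.scheme}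
    (h1 : w * L.ω₁ = (N 0 0 : ℂ) * L.ω₁ + (N 0 1 : ℂ) * L.ω₂)
    (h2 : w * L.ω₂ = (N 1 0 : ℂ) * L.ω₁ + (N 1 1 : ℂ) * L.ω₂)
    (hact : ∀ z : ℂ, L.upoint z ≫ k = L.upoint (w * z)) (t : Torus 2) :
    L.torusPoint t ≫ k = L.torusPoint (torusMap N.transpose t) := by
  set x : Fin 2 → ℝ := ComplexTorus.lift L.periodIso t
  obtain ⟨y, hy⟩ : ∃ y : Fin 2 → ℝ, ∀ m, y m = (N 0 m : ℝ) * x 0 + (N 1 m : ℝ) * x 1 :=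
    ⟨_, fun m => rfl⟩
  have hxt : ∀ j, ((x j : ℝ) : UnitAddCircle) = t j := fun j => AddCircle.coe_equivIco
  have hwz : w * L.periodIso x = L.periodIso y := by
    rw [PeriodPair.periodIso_apply, PeriodPair.periodIso_apply, hy 0, hy 1]
    push_cast
    linear_combination (x 0 : ℂ) * h1 + (x 1 : ℂ) * h2
  have hNt : torusMap N.transpose t = ComplexTorus.cover L.periodIso (L.periodIso y) := by
    rw [ComplexTorus.cover_apply_apply]
    funext m
    rw [torusMap_apply, ComplexTorus.proj_apply, hy m]
    simp only [Fin.sum_univ_two, Matrix.transpose_apply, ← hxt, AddCircle.coe_add, ← zsmul_eq_mul,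
      AddCircle.coe_zsmul]
  change L.upoint (L.periodIso x) ≫ k = L.torusPoint (torusMap N.transpose t)
  rw [hact, hwz, hNt]
  exact (L.torusPoint_cover _).symm

end Curve

/-! ### Transport of `H•(T²)` along a homeomorphism `Θ : T² ≃ₜ Y` -/

section Transport

variable {Y : Type} [TopologicalSpace Y]

/-- `dim Hᵏ(Y; ℂ) = (2 choose k)` for `Y ≃ₜ T²`. [cite: HatcherAT2002, §3.2 Example 3.16] -/
theorem tm_finrank (Θ : Torus 2 ≃ₜ Y) (k : ℕ) :
    Module.finrank ℂ (singularCohomology ℂ ℂ Y k) = Nat.choose 2 k := by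
  rw [← (singularCohomology.mapIso ℂ ℂ Θ.symm k).toLinearEquiv.finrank_eq,
    finrank_singularCohomology_torus]

/-- The classes `(Θ⁻¹)^* ξᵢ` are rational (`ξᵢ` is defined over `ℚ`). [cite: HatcherAT2002, §3.1 p. 198] -/
theorem tm_rational (Θ : Torus 2 ≃ₜ Y) (i : Fin 2) :
    IsRationalClass (singularCohomology.map ℂ ℂ (Θ.symm : C(Y, Torus 2)) 1 (torusXi ℂ 2 i)) := by
  rw [← ringChange_torusXi (algebraMap ℚ ℂ) 2 i]
  exact (isRationalClass_ringChange _).map _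

/-- The degree-one monomial `ξ_e` of `Tⁿ` is the coordinate class `ξ_{e 0}`.
[cite: HatcherAT2002, §3.2 Example 3.16] -/
theorem tm_torusMonomial_one {n : ℕ} (e : Fin 1 → Fin n) :
    torusMonomial ℂ n 1 e = torusXi ℂ n (e 0) :=
  one_cupProduct _

/-- The coordinate classes span `H¹(T²; ℂ)`. [cite: HatcherAT2002, §3.2 Example 3.16] -/
theorem tm_span_torusXi : Submodule.span ℂ (Set.range (torusXi ℂ 2)) = ⊤ := by
  refine eq_top_iff.mpr ((span_torusMonomial ℂ 2 1).ge.trans (Submodule.span_le.mpr ?_))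
  rintro _ ⟨s, rfl⟩
  change torusMonomial ℂ 2 1 (subsetEmb s) ∈ _
  rw [tm_torusMonomial_one]
  exact Submodule.subset_span ⟨_, rfl⟩

/-- **The classes `(Θ⁻¹)^* ξ₀, (Θ⁻¹)^* ξ₁` span `H¹(Y; ℂ)`.**
[cite: HatcherAT2002, §3.2 Example 3.16] -/
theorem tm_span (Θ : Torus 2 ≃ₜ Y) :
    Submodule.span ℂ
      (Set.range fun i => singularCohomology.map ℂ ℂ (Θ.symm : C(Y, Torus 2)) 1 (torusXi ℂ 2 i)) = ⊤ := by
  set e := (singularCohomology.mapIso ℂ ℂ Θ.symm 1).toLinearEquiv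
  have hx : (fun i => singularCohomology.map ℂ ℂ (Θ.symm : C(Y, Torus 2)) 1 (torusXi ℂ 2 i)) =
      e ∘ torusXi ℂ 2 := rfl
  rw [hx, Set.range_comp, Submodule.span_image_linearEquiv, tm_span_torusXi, Submodule.map_top,
    LinearEquiv.range]

/-- **The classes `(Θ⁻¹)^* ξ₀, (Θ⁻¹)^* ξ₁` are linearly independent** (`dim H¹ = 2`).
[cite: HatcherAT2002, §3.2 Example 3.16] -/
theorem tm_linearIndependent (Θ : Torus 2 ≃ₜ Y) :
    LinearIndependent ℂ fun i => singularCohomology.map ℂ ℂ (Θ.symm : C(Y, Torus 2)) 1 (torusXi ℂ 2 i) :=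
  linearIndependent_of_top_le_span_of_card_eq_finrank (tm_span Θ).ge
    (by rw [tm_finrank Θ, Fintype.card_fin]; rfl)

/-- `(Θ⁻¹)^* ξ₀ ⌣ (Θ⁻¹)^* ξ₁ = (Θ⁻¹)^*(ξ₀ ⌣ ξ₁)`. [cite: HatcherAT2002, §3.2 Example 3.16] -/
theorem tm_cup_eq (Θ : Torus 2 ≃ₜ Y) :
    cupProduct (rfl : 1 + 1 = 2) (singularCohomology.map ℂ ℂ (Θ.symm : C(Y, Torus 2)) 1 (torusXi ℂ 2 0))
        (singularCohomology.map ℂ ℂ (Θ.symm : C(Y, Torus 2)) 1 (torusXi ℂ 2 1)) =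
      singularCohomology.map ℂ ℂ (Θ.symm : C(Y, Torus 2)) 2 (torusTop ℂ 2) := by
  have h2 : torusTop ℂ 2 = cupProduct (rfl : 1 + 1 = 2) (torusXi ℂ 2 0) (torusXi ℂ 2 1) := by
    change cupProduct _ (cupProduct _ (singularCohomology.one ℂ (Torus 2)) (torusXi ℂ 2 0))
      (torusXi ℂ 2 1) = _
    have h : cupProduct (rfl : 0 + 1 = 0 + 1) (singularCohomology.one ℂ (Torus 2)) (torusXi ℂ 2 0) =
        torusXi ℂ 2 0 := one_cupProduct _
    rw [h]
  rw [h2, cupProduct_map]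

/-- **`(Θ⁻¹)^* ξ₀ ⌣ (Θ⁻¹)^* ξ₁ ≠ 0`** (`ξ₀ ⌣ ξ₁ ≠ 0` on `T²`).
[cite: HatcherAT2002, §3.2 Example 3.16] -/
theorem tm_cup_ne_zero (Θ : Torus 2 ≃ₜ Y) :
    cupProduct (rfl : 1 + 1 = 2) (singularCohomology.map ℂ ℂ (Θ.symm : C(Y, Torus 2)) 1 (torusXi ℂ 2 0))
        (singularCohomology.map ℂ ℂ (Θ.symm : C(Y, Torus 2)) 1 (torusXi ℂ 2 1)) ≠ 0 := by
  rw [tm_cup_eq]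
  exact (singularCohomology.mapIso ℂ ℂ Θ.symm 2).toLinearEquiv.map_ne_zero_iff.mpr
    (torusTop_ne_zero (R := ℂ) 2)

/-- **`H²(Y; ℂ)` is the line spanned by `(Θ⁻¹)^* ξ₀ ⌣ (Θ⁻¹)^* ξ₁`** (`dim H² = 1`).
[cite: HatcherAT2002, §3.2 Example 3.16] -/
theorem tm_line (Θ : Torus 2 ≃ₜ Y) (c : singularCohomology ℂ ℂ Y 2) :
    ∃ t : ℂ, c = t • cupProduct (rfl : 1 + 1 = 2)
      (singularCohomology.map ℂ ℂ (Θ.symm : C(Y, Torus 2)) 1 (torusXi ℂ 2 0))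
      (singularCohomology.map ℂ ℂ (Θ.symm : C(Y, Torus 2)) 1 (torusXi ℂ 2 1)) := by
  have h1 : Module.finrank ℂ (singularCohomology ℂ ℂ Y 2) = 1 := by rw [tm_finrank Θ]; rfl
  obtain ⟨t, ht⟩ := (finrank_eq_one_iff_of_nonzero' _ (tm_cup_ne_zero Θ)).mp h1 c
  exact ⟨t, ht.symm⟩

/-- **A self-map `F` of `Y` conjugate under `Θ` to the torus map `f_A` acts on the `(Θ⁻¹)^* ξᵢ` by
`Aᵀ`**: `F^*((Θ⁻¹)^* ξᵢ) = Σⱼ Aᵢⱼ (Θ⁻¹)^* ξⱼ` (`f_A^* ξᵢ = Σⱼ Aᵢⱼ ξⱼ`).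
[cite: HatcherAT2002, §3.C Exercise 11] -/
theorem tm_map_of_conj (Θ : Torus 2 ≃ₜ Y) (F : C(Y, Y)) (A : Matrix (Fin 2) (Fin 2) ℤ)
    (h : ∀ t, F (Θ t) = Θ (torusMap A t)) (i : Fin 2) :
    singularCohomology.map ℂ ℂ F 1 (singularCohomology.map ℂ ℂ (Θ.symm : C(Y, Torus 2)) 1 (torusXi ℂ 2 i)) =
      ∑ j, ((A i j : ℤ) : ℂ) • singularCohomology.map ℂ ℂ (Θ.symm : C(Y, Torus 2)) 1 (torusXi ℂ 2 j) := by
  have hc : (Θ.symm : C(Y, Torus 2)).comp F = (torusMap A).comp (Θ.symm : C(Y, Torus 2)) := by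
    refine ContinuousMap.ext fun P => ?_
    change Θ.symm (F P) = torusMap A (Θ.symm P)
    obtain ⟨t, rfl⟩ := Θ.surjective P
    rw [h t, Homeomorph.symm_apply_apply, Homeomorph.symm_apply_apply]
  rw [singularCohomology.map_map, hc, ← singularCohomology.map_map, map_torusMap_torusXi, map_sum]
  refine Finset.sum_congr rfl fun j _ => ?_
  rw [map_smul]

/-- **Additivity**: if `Θ` is multiplicative for a product on `Y`, then `H^*((Θ⁻¹)^* ξᵢ) =
F^*((Θ⁻¹)^* ξᵢ) + G^*((Θ⁻¹)^* ξᵢ)` for `H = F·G` pointwise (`(u + v)^* θ = u^* θ + v^* θ` for maps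
to `ℝ/ℤ`). [cite: HatcherAT2002, §3.C Exercise 11] -/
theorem tm_map_of_mul (Θ : Torus 2 ≃ₜ Y) [Mul Y] (hΘ : ∀ s t, Θ (s + t) = Θ s * Θ t) {Z : Type}
    [TopologicalSpace Z] (F G H : C(Z, Y)) (hH : ∀ z, H z = F z * G z) (i : Fin 2) :
    singularCohomology.map ℂ ℂ H 1 (singularCohomology.map ℂ ℂ (Θ.symm : C(Y, Torus 2)) 1 (torusXi ℂ 2 i)) =
      singularCohomology.map ℂ ℂ F 1 (singularCohomology.map ℂ ℂ (Θ.symm : C(Y, Torus 2)) 1 (torusXi ℂ 2 i)) +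
        singularCohomology.map ℂ ℂ G 1
          (singularCohomology.map ℂ ℂ (Θ.symm : C(Y, Torus 2)) 1 (torusXi ℂ 2 i)) := by
  have hsymm : ∀ P Q, Θ.symm (P * Q) = Θ.symm P + Θ.symm Q := fun P Q => by
    apply Θ.injective
    rw [Homeomorph.apply_symm_apply, hΘ, Homeomorph.apply_symm_apply, Homeomorph.apply_symm_apply]
  have hx : singularCohomology.map ℂ ℂ (Θ.symm : C(Y, Torus 2)) 1 (torusXi ℂ 2 i) =
      singularCohomology.map ℂ ℂ ((torusProj 2 i).comp (Θ.symm : C(Y, Torus 2))) 1 (circleClass ℂ) := by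
    rw [torusXi, singularCohomology.map_map]
  have hc : ((torusProj 2 i).comp (Θ.symm : C(Y, Torus 2))).comp H =
      ((torusProj 2 i).comp (Θ.symm : C(Y, Torus 2))).comp F +
        ((torusProj 2 i).comp (Θ.symm : C(Y, Torus 2))).comp G := by
    refine ContinuousMap.ext fun z => ?_
    change Θ.symm (H z) i = Θ.symm (F z) i + Θ.symm (G z) i
    rw [hH, hsymm]
    rfl
  rw [hx, singularCohomology.map_map, singularCohomology.map_map, singularCohomology.map_map, hc,
    map_add_circleClass]

end Transport

/-! ### Abelian varieties: additivity in the morphism -/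

open scoped MonObj in
/-- **`(f + g)^* xᵢ = f^* xᵢ + g^* xᵢ` on `Hom(T, A)`** for a complex abelian variety `A` with a
homeomorphism `Θ : T² ≃ₜ A(ℂ)` that is a homomorphism (`Θ(s + t) = ⟨Θ s, Θ t⟩ ≫ μ`) and
`xᵢ = (Θ⁻¹)^* ξᵢ` (`(f + g)(ℂ) = f(ℂ)·g(ℂ)` pointwise, Mumford §4; then `tm_map_of_mul`).
[cite: MumfordAV1970, §4] -/
theorem tm_map_add {A : AbelianVariety ℂ} (Θ : Torus 2 ≃ₜ ComplexPoints A.X)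
    (hΘ : ∀ s t, Θ (s + t) = lift (Θ s) (Θ t) ≫ MonObj.mul) {T : AbelianVariety ℂ} (f g : T ⟶ A)
    (i : Fin 2) :
    complexBetti.map (f + g).hom.hom.hom 1
        (singularCohomology.map ℂ ℂ (Θ.symm : C(ComplexPoints A.X, Torus 2)) 1 (torusXi ℂ 2 i)) =
      complexBetti.map f.hom.hom.hom 1
          (singularCohomology.map ℂ ℂ (Θ.symm : C(ComplexPoints A.X, Torus 2)) 1 (torusXi ℂ 2 i)) +
        complexBetti.map g.hom.hom.hom 1
          (singularCohomology.map ℂ ℂ (Θ.symm : C(ComplexPoints A.X, Torus 2)) 1 (torusXi ℂ 2 i)) :=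
  tm_map_of_mul Θ (fun s t => hΘ s t) (AlgPoints.mapContinuous (L := ℂ) f.hom.hom.hom)
    (AlgPoints.mapContinuous (L := ℂ) g.hom.hom.hom)
    (AlgPoints.mapContinuous (L := ℂ) (f + g).hom.hom.hom)
    (fun P => by
      change P ≫ (f.hom.hom.hom * g.hom.hom.hom) = (P ≫ f.hom.hom.hom) * (P ≫ g.hom.hom.hom)
      exact MonObj.comp_mul _ _ _) i

/-! ### The stub -/

/-- **Stub T_A2 (r5) — the degree-one model of an endomorphism acting linearly on the uniformisation.**
For a period pair `L`, `w ∈ ℂ` with `w·ωⱼ = Σₖ Nⱼₖ ωₖ` (`N ∈ M₂(ℤ)`), and an endomorphism `ι` of `E_Λ`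
acting on complex points as `π(z) ↦ π(wz)`: `H¹(E_Λ(ℂ); ℂ)` has a basis of two RATIONAL classes `x₀, x₁`
(the coordinate classes `(Θ⁻¹)^*ξᵢ` of the uniformisation `Θ : T² ≃ₜ E_Λ(ℂ)`,
`PeriodPair.isHomeomorph_torusPoint`) on which `ι^*` acts by the TRANSPOSE of `N`
(`ι^* xᵢ = Σⱼ Nⱼᵢ xⱼ`: under `Θ`, `ι` is the torus map `t ↦ (Σⱼ Nⱼᵢ tⱼ)ᵢ`, Hatcher §3.C Ex. 11,
`map_torusMap_torusXi`), pull-back of `xᵢ` is ADDITIVE in the morphism (`map_add_circleClass`),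
`x₀ ⌣ x₁ ≠ 0` and `H²(E_Λ(ℂ); ℂ) = ℂ·(x₀ ⌣ x₁)` (`torusTop_ne_zero`,
`finrank_singularCohomology_torus`). [cite: HatcherAT2002, §3.2 Example 3.16 and §3.C Exercise 11] -/
theorem stub_torusModel :
    ∀ (L : PeriodPair) (w : ℂ) (N : Matrix (Fin 2) (Fin 2) ℤ) (ι : (L.curve.abelianVarietyOfAddHom L.curve.addHom L.curve.negHom L.curve.lift_pointEquiv_comp_addHom
          L.curve.pointEquiv_comp_negHom_geom) ⟶
        (L.curve.abelianVarietyOfAddHom L.curve.addHom L.curve.negHom L.curve.lift_pointEquiv_comp_addHom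
          L.curve.pointEquiv_comp_negHom_geom)),
      (w * L.ω₁ = (N 0 0 : ℂ) * L.ω₁ + (N 0 1 : ℂ) * L.ω₂) →
      (w * L.ω₂ = (N 1 0 : ℂ) * L.ω₁ + (N 1 1 : ℂ) * L.ω₂) →
      (∀ z : ℂ, L.upoint z ≫ ι.hom.hom.hom = L.upoint (w * z)) →
      ∃ x : Fin 2 → complexBetti (L.curve.abelianVarietyOfAddHom L.curve.addHom L.curve.negHom L.curve.lift_pointEquiv_comp_addHom
          L.curve.pointEquiv_comp_negHom_geom).X 1,
        (∀ i, IsRationalClass (x i)) ∧ LinearIndependent ℂ x ∧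
        Submodule.span ℂ (Set.range x) = ⊤ ∧
        (∀ i, complexBetti.map ι.hom.hom.hom 1 (x i) = ∑ j, ((N j i : ℤ) : ℂ) • x j) ∧
        (∀ (T : AbelianVariety ℂ) (f g : T ⟶ (L.curve.abelianVarietyOfAddHom L.curve.addHom L.curve.negHom L.curve.lift_pointEquiv_comp_addHom
          L.curve.pointEquiv_comp_negHom_geom)) (i : Fin 2),
          complexBetti.map (f + g).hom.hom.hom 1 (x i) =
            complexBetti.map f.hom.hom.hom 1 (x i) + complexBetti.map g.hom.hom.hom 1 (x i)) ∧
        cupProduct (rfl : 1 + 1 = 2) (x 0) (x 1) ≠ 0 ∧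
        (∀ c : complexBetti (L.curve.abelianVarietyOfAddHom L.curve.addHom L.curve.negHom L.curve.lift_pointEquiv_comp_addHom
          L.curve.pointEquiv_comp_negHom_geom).X 2, ∃ t : ℂ, c = t • cupProduct (rfl : 1 + 1 = 2) (x 0) (x 1)) := by
  intro L w N ι h1 h2 hact
  -- the uniformisation `Θ : T² ≃ₜ E_Λ(ℂ)`, `Θ t = torusPoint t`: a homomorphism conjugating `ι(ℂ)`
  -- to the torus map of `Nᵀ`
  obtain ⟨Θ, hΘ⟩ : ∃ Θ : Torus 2 ≃ₜ ComplexPoints (L.curve.abelianVarietyOfAddHom L.curve.addHom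
      L.curve.negHom L.curve.lift_pointEquiv_comp_addHom L.curve.pointEquiv_comp_negHom_geom).X,
      ∀ t, Θ t = L.torusPoint t :=
    ⟨IsHomeomorph.homeomorph (fun t : Torus 2 => (L.torusPoint t : ComplexPoints
      (L.curve.abelianVarietyOfAddHom L.curve.addHom L.curve.negHom L.curve.lift_pointEquiv_comp_addHom
        L.curve.pointEquiv_comp_negHom_geom).X)) L.isHomeomorph_torusPoint, fun t => rfl⟩
  have hconj : ∀ t, AlgPoints.mapContinuous (L := ℂ) ι.hom.hom.hom (Θ t) =
      Θ (torusMap N.transpose t) := fun t => by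
    rw [hΘ, hΘ]; exact tm_torusPoint_conj L h1 h2 hact t
  have hmul : ∀ s t : Torus 2, Θ (s + t) = lift (Θ s) (Θ t) ≫ MonObj.mul := fun s t => by
    rw [hΘ, hΘ, hΘ]; exact tm_torusPoint_add L s t
  -- `xᵢ = (Θ⁻¹)^* ξᵢ`
  refine ⟨fun i => singularCohomology.map ℂ ℂ (Θ.symm : C(ComplexPoints (L.curve.abelianVarietyOfAddHom
      L.curve.addHom L.curve.negHom L.curve.lift_pointEquiv_comp_addHom L.curve.pointEquiv_comp_negHom_geom).X,
      Torus 2)) 1 (torusXi ℂ 2 i),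
    fun i => tm_rational Θ i, tm_linearIndependent Θ, tm_span Θ, fun i => ?_,
    fun T f g i => tm_map_add Θ hmul f g i, tm_cup_ne_zero Θ, tm_line Θ⟩
  refine (tm_map_of_conj Θ (AlgPoints.mapContinuous (L := ℂ) ι.hom.hom.hom) N.transpose hconj i).trans
    (Finset.sum_congr rfl fun j _ => ?_)
  rw [Matrix.transpose_apply]

end Summit.HodgeConjecture.HodgeConjecture.Theorems.WeilTwelvefoldsSqrtMinus7.AmnesicSecantSheaves

end
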